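import Literature.AlgebraicGeometry.Resolution.PerronTransforms
import Mathlib.Algebra.Order.GroupWithZero.Canonical
import Mathlib.RingTheory.Coprime.Lemmas
import Mathlib.LinearAlgebra.Dimension.Constructions

/-!
# `Valuative.LuAlphaPTorsor`, line `pfaff-line-log-final-forms`: the value step — lattice helpers

Route `ResolutionOfSingularities/Valuative`, crux `LuAlphaPTorsor`
(stmt-ResolutionOfSingularities-0641), line `pfaff-line-log-final-forms`, stub `stub_valueStep`
(the VALUE STEP of the purely inseparable tower: `t ^ p = x^α · u`, `v(t) ∉ ⊕ ℤ v(xᵢ)`).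
This file is the value-group combinatorics of that stub, stated in an abstract linearly
ordered commutative group with zero `Γ₀` (the value group of the place):

* `valueStep_lattice_rebase` — TORIC RE-BASING. For `ℤ`-independent non-zero values
  `τ₁, …, τₙ ≤ 1` and a non-zero value `θ ≤ 1` with `θ ^ p ∈ ⟨τ⟩` (`p ≠ 0`), the lattice
  `Γ' = ⟨τ, θ⟩ ⊆ Γ₀ˣ` has rank `n` (it is torsion-free, contains `⟨τ⟩ ≅ ℤⁿ`, and
  `(Γ')^p ⊆ ⟨τ⟩`), and Zariski–Perron (`exists_basis_lt_one_of_injective`, PROVED in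
  `Literature/…/PerronTransforms.lean`, Temkin 2013 Thm. A.2.1 / Knaf–Kuhlmann 2005 Lemma 4.2)
  gives a `ℤ`-basis `ε₁, …, εₙ < 1` of `Γ'` in which the `τᵢ` and `θ` are monomials with
  exponents in `ℕ`; the `εⱼ` are Laurent monomials in `τ, θ` and are `ℤ`-independent.
* `valueStep_kernel` — if moreover `p` is prime and `θ ∉ ⟨τ⟩`, then a relation
  `τ^a · θ ^ r = 1` with `0 ≤ r < p` forces `r = 0` and `a = 0` (Bezout).

No field, valuation ring or characteristic hypothesis appears here; the field-side assembly
of the stub is `ValuativeLuAlphaPTorsorValueStep.lean`.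
-/

noncomputable section

-- `Summit.<S>.<S>.…` duplicates the summit name by design (D-0017, single-problem summit).
set_option linter.dupNamespace false

namespace Summit.ResolutionOfSingularities.ResolutionOfSingularities.Theorems.PfaffLine

open Literature.AlgebraicGeometry.Resolution

section Lattice

variable {Γ₀ : Type*} [CommGroupWithZero Γ₀]

/-- Laurent monomials are additive in the exponent: `τ^(a + b) = τ^a · τ^b` (`τᵢ ≠ 0`). -/
theorem prod_zpow_add_eq {n : ℕ} (τ : Fin n → Γ₀) (hτ0 : ∀ i, τ i ≠ 0) (a b : Fin n → ℤ) :
    ∏ i, τ i ^ (a + b) i = (∏ i, τ i ^ a i) * ∏ i, τ i ^ b i := by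
  rw [← Finset.prod_mul_distrib]
  exact Finset.prod_congr rfl fun i _ => zpow_add₀ (hτ0 i) _ _

/-- Laurent monomials: `τ^(c • a) = (τ^a) ^ c`. -/
theorem prod_zpow_smul_eq {n : ℕ} (τ : Fin n → Γ₀) (c : ℤ) (a : Fin n → ℤ) :
    ∏ i, τ i ^ (c • a) i = (∏ i, τ i ^ a i) ^ c := by
  rw [← Finset.prod_zpow]
  exact Finset.prod_congr rfl fun i _ => by rw [Pi.smul_apply, smul_eq_mul, mul_comm, zpow_mul]

/-- Laurent monomials: `τ^(-a) = (τ^a)⁻¹`. -/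
theorem prod_zpow_neg_eq {n : ℕ} (τ : Fin n → Γ₀) (a : Fin n → ℤ) :
    ∏ i, τ i ^ (-a) i = (∏ i, τ i ^ a i)⁻¹ := by
  rw [← Finset.prod_inv_distrib]
  exact Finset.prod_congr rfl fun i _ => by rw [Pi.neg_apply, zpow_neg]

end Lattice

section Rebase

variable {Γ₀ : Type*} [LinearOrderedCommGroupWithZero Γ₀]

/-- **Toric re-basing of the value lattice** (see the module docstring). For non-zero values
`τᵢ ≤ 1` (`i < n`) that are `ℤ`-independent and a non-zero value `θ ≤ 1` with
`θ ^ p = ∏ τᵢ ^ αᵢ`, `p ≠ 0`, there are `n` values `εⱼ < 1`, Laurent monomials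
`εⱼ = τ^{A j} · θ ^ {B j}` in `τ, θ`, such that every `τᵢ` and `θ` is a monomial in the `εⱼ`
with exponents in `ℕ`, and the `εⱼ` are `ℤ`-independent. (Zariski–Perron applied to the rank-`n`
lattice `⟨τ, θ⟩ ⊆ Γ₀ˣ`.) Registered sub-goal of the crux (one-line signature). -/
theorem valueStep_lattice_rebase :
    ∀ {Γ₀ : Type} [LinearOrderedCommGroupWithZero Γ₀] {p : ℕ}, p ≠ 0 → ∀ {n : ℕ} (τ : Fin n → Γ₀), (∀ i, τ i ≠ 0) → (∀ i, τ i ≤ 1) → (∀ m : Fin n → ℤ, (∏ i, τ i ^ (m i)) = 1 → m = 0) → ∀ (θ : Γ₀), θ ≠ 0 → θ ≤ 1 → ∀ (α : Fin n → ℕ), θ ^ p = ∏ i, τ i ^ (α i) → ∃ (ε : Fin n → Γ₀) (A : Fin n → Fin n → ℤ) (B : Fin n → ℤ) (C : Fin n → Fin n → ℕ) (D : Fin n → ℕ), (∀ j, ε j ≠ 0) ∧ (∀ j, ε j < 1) ∧ (∀ j, ε j = (∏ i, τ i ^ (A j i)) * θ ^ (B j)) ∧ (∀ i, τ i = ∏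 j, ε j ^ (C i j)) ∧ θ = ∏ j, ε j ^ (D j) ∧ ∀ m : Fin n → ℤ, (∏ j, ε j ^ (m j)) = 1 → m = 0 := by
  intro Γ₀ _ p hp n τ hτ0 hτ1 hind θ hθ0 hθ1 α hθp
  classical
  -- ### the lattice `V = ⟨τ, θ⟩ ⊆ Γ₀ˣ`, written additively, and its sublattice `L = ⟨τ⟩`
  let g : Option (Fin n) → Γ₀ˣ := fun o =>
    o.elim (Units.mk0 θ hθ0) fun i => Units.mk0 (τ i) (hτ0 i)
  let e : Option (Fin n) → Additive Γ₀ˣ := fun o => Additive.ofMul (g o)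
  let es : Fin n → Additive Γ₀ˣ := fun i => e (some i)
  let V : Submodule ℤ (Additive Γ₀ˣ) := Submodule.span ℤ (Set.range e)
  let L : Submodule ℤ (Additive Γ₀ˣ) := Submodule.span ℤ (Set.range es)
  -- values in `Γ₀`
  let val : Additive Γ₀ˣ → Γ₀ := fun a => ((Additive.toMul a : Γ₀ˣ) : Γ₀)
  have val_zero : val 0 = 1 := by simp [val]
  have val_ne : ∀ a, val a ≠ 0 := fun a => (Additive.toMul a).ne_zero
  have val_nsmul : ∀ (n : ℕ) a, val (n • a) = val a ^ n := fun n a => by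
    simp only [val, toMul_nsmul, Units.val_pow_eq_pow_val]
  have val_zsmul : ∀ (n : ℤ) a, val (n • a) = val a ^ n := fun n a => by
    simp only [val, toMul_zsmul, Units.val_zpow_eq_zpow_val]
  have val_add : ∀ a b, val (a + b) = val a * val b := fun a b => by
    simp only [val, toMul_add, Units.val_mul]
  have val_sum : ∀ {ι : Type} (s : Finset ι) (f : ι → Additive Γ₀ˣ),
      val (∑ i ∈ s, f i) = ∏ i ∈ s, val (f i) := fun s f => by
    simp only [val, toMul_sum, Units.coe_prod]
  have val_es : ∀ i, val (es i) = τ i := fun i => by simp [val, es, e, g]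
  have val_e_none : val (e none) = θ := by simp [val, e, g]
  have val_inj : Function.Injective val := fun a b h =>
    Additive.toMul.injective (Units.ext h)
  have val_lt : ∀ a, val a < 1 ↔ Additive.toMul a < 1 := fun a => by
    rw [← Units.val_lt_val, Units.val_one]
  have val_le : ∀ a, val a ≤ 1 ↔ Additive.toMul a ≤ 1 := fun a => by
    rw [← Units.val_le_val, Units.val_one]
  -- Laurent monomials in `τ`
  let mono : (Fin n → ℤ) → Γ₀ := fun c => ∏ i, τ i ^ c i
  have val_lin : ∀ c : Fin n → ℤ, val (∑ i, c i • es i) = mono c := fun c => by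
    rw [val_sum]
    exact Finset.prod_congr rfl fun i _ => by rw [val_zsmul, val_es]
  have val_V : ∀ c : Option (Fin n) → ℤ,
      val (∑ o, c o • e o) = θ ^ (c none) * mono (fun i => c (some i)) := fun c => by
    rw [Fintype.sum_option, val_add, val_zsmul, val_e_none, ← val_lin]
  -- the relation `p • θ = ∑ αᵢ • τᵢ`
  have hrel : (p : ℤ) • e none = ∑ i, (α i : ℤ) • es i := by
    apply val_inj
    rw [val_zsmul, val_e_none, val_lin, zpow_natCast, hθp]
    exact Finset.prod_congr rfl fun i _ => (zpow_natCast _ _).symm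
  -- ### finiteness
  haveI hVfin : Module.Finite ℤ V := Module.Finite.span_of_finite ℤ (Set.finite_range e)
  haveI hLfin : Module.Finite ℤ L := Module.Finite.span_of_finite ℤ (Set.finite_range es)
  have hLV : L ≤ V := Submodule.span_mono (by rintro _ ⟨i, rfl⟩; exact ⟨some i, rfl⟩)
  -- ### `p • V ⊆ L`
  have hpV : ∀ x ∈ V, (p : ℤ) • x ∈ L := by
    intro x hx
    refine Submodule.span_induction (p := fun x _ => (p : ℤ) • x ∈ L) ?_ ?_ ?_ ?_ hx
    · rintro _ ⟨o, rfl⟩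
      cases o with
      | none =>
        rw [hrel]
        exact L.sum_mem fun i _ => L.smul_mem _ (Submodule.subset_span ⟨i, rfl⟩)
      | some i => exact L.smul_mem _ (Submodule.subset_span ⟨i, rfl⟩)
    · rw [smul_zero]; exact L.zero_mem
    · intro x y _ _ hx hy
      rw [smul_add]; exact L.add_mem hx hy
    · intro a x _ hx
      rw [smul_comm]; exact L.smul_mem a hx
  -- ### the rank of `V` is `n`
  have hLrank : Module.finrank ℤ L = n := by
    let ψ : (Fin n → ℤ) →ₗ[ℤ] Additive Γ₀ˣ := Fintype.linearCombination ℤ es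
    have hψ : Function.Injective ψ := by
      refine (injective_iff_map_eq_zero ψ).mpr fun c hc => hind c ?_
      change mono c = 1
      rw [← val_lin, ← val_zero, ← hc]
      rfl
    have h1 := LinearMap.finrank_range_of_inj hψ
    rw [Fintype.range_linearCombination, Module.finrank_fin_fun] at h1
    exact h1
  have hrank : Module.finrank ℤ V = n := by
    refine le_antisymm ?_ (hLrank ▸ Submodule.finrank_mono hLV)
    let ψ : V →ₗ[ℤ] Additive Γ₀ˣ := (p : ℤ) • V.subtype
    have hψ : Function.Injective ψ := by
      intro x y hxy
      have h : (p : ℤ) • (x : Additive Γ₀ˣ) = (p : ℤ) • (y : Additive Γ₀ˣ) := hxy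
      have h' : val x ^ p = val y ^ p := by
        rw [← zpow_natCast, ← zpow_natCast, ← val_zsmul, ← val_zsmul, h]
      exact Subtype.ext (val_inj (pow_left_injective hp h'))
    have hle : LinearMap.range ψ ≤ L := by
      rintro _ ⟨x, rfl⟩
      exact hpV x x.2
    calc Module.finrank ℤ V = Module.finrank ℤ (LinearMap.range ψ) :=
          (LinearMap.finrank_range_of_inj hψ).symm
      _ ≤ Module.finrank ℤ L := Submodule.finrank_mono hle
      _ = n := hLrank
  -- ### Zariski–Perron: a basis of `V` of elements `< 1` making `τ, θ` non-negative
  haveI : AddGroup.FG V := Module.Finite.iff_addGroup_fg.mp hVfin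
  have he_mem : ∀ o, e o ∈ V := fun o => Submodule.subset_span (Set.mem_range_self o)
  let eV : Option (Fin n) → V := fun o => ⟨e o, he_mem o⟩
  obtain ⟨b, hb1, -, hbS⟩ := exists_basis_lt_one_of_injective V.subtype.toAddMonoidHom
    (fun a b h => Subtype.ext h) (Finset.univ.image eV) (by
      intro d hd
      obtain ⟨o, -, rfl⟩ := Finset.mem_image.mp hd
      rw [← val_le]
      cases o with
      | none => simpa [eV, val_e_none] using hθ1
      | some i => simpa [eV, val_es, es] using hτ1 i)
  -- reindex by `Fin n`
  let σ : Fin (Module.finrank ℤ V) ≃ Fin n := finCongr hrank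
  let b' : Module.Basis (Fin n) ℤ V := b.reindex σ
  have hb' : ∀ j, b' j = b (σ.symm j) := fun j => Module.Basis.reindex_apply _ _ _
  let ε : Fin n → Γ₀ := fun j => val (b' j : Additive Γ₀ˣ)
  -- ### the basis elements are Laurent monomials in `τ, θ`
  have hAB : ∀ j, ∃ (A : Fin n → ℤ) (B : ℤ), ε j = (∏ i, τ i ^ (A i)) * θ ^ B := fun j => by
    obtain ⟨c, hc⟩ := (Submodule.mem_span_range_iff_exists_fun ℤ).mp (b' j).2
    refine ⟨fun i => c (some i), c none, ?_⟩
    change val _ = _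
    rw [← hc, val_V, mul_comm]
  choose A B hAB using hAB
  -- ### `τ, θ` are monomials in the basis with exponents in `ℕ`
  have hCD : ∀ o, ∃ c : Fin n → ℕ, val (e o) = ∏ j, ε j ^ (c j) := fun o => by
    obtain ⟨c, hc⟩ := hbS (eV o) (Finset.mem_image_of_mem _ (Finset.mem_univ o))
    refine ⟨fun j => c (σ.symm j), ?_⟩
    have h1 : (eV o : Additive Γ₀ˣ) = ∑ j, c (σ.symm j) • (b' j : Additive Γ₀ˣ) := by
      rw [hc, Submodule.coe_sum]
      refine Fintype.sum_equiv σ _ _ fun i => ?_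
      rw [Submodule.coe_smul_of_tower, hb', Equiv.symm_apply_apply]
    change val (eV o : Additive Γ₀ˣ) = _
    rw [h1, val_sum]
    exact Finset.prod_congr rfl fun j _ => val_nsmul _ _
  choose Cf hCf using hCD
  refine ⟨ε, A, B, fun i => Cf (some i), Cf none, fun j => val_ne _, fun j => ?_, hAB,
    fun i => ?_, ?_, fun m hm => ?_⟩
  · -- `ε j < 1`
    change val _ < 1
    rw [val_lt, hb']
    exact hb1 (σ.symm j)
  · rw [← hCf (some i), ← val_es]
  · rw [← hCf none, val_e_none]
  · -- `ℤ`-independence of a `ℤ`-basis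
    have h1 : ∑ j, m j • b' j = 0 := by
      apply Subtype.ext
      apply val_inj
      rw [Submodule.coe_sum, val_sum, Submodule.coe_zero, val_zero, ← hm]
      exact Finset.prod_congr rfl fun j _ => by rw [Submodule.coe_smul, val_zsmul]
    funext j
    exact Fintype.linearIndependent_iff.mp b'.linearIndependent m h1 j

/-- **The kernel of `(a, r) ↦ τ^a · θ ^ r` on `0 ≤ r < p`.** If `p` is prime, the `τᵢ` are
`ℤ`-independent, `θ ^ p = τ^α` and `θ` itself is NOT a Laurent monomial in the `τᵢ`, then
`τ^a · θ ^ r = 1` with `r < p` forces `r = 0` and `a = 0`: otherwise `r` is prime to `p` and a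
Bezout relation `s p + s' r = 1` exhibits `θ = (θ^p)^s (θ^r)^{s'}` as a monomial in `τ`. -/
theorem valueStep_kernel {p : ℕ} (hp : p.Prime) {n : ℕ} (τ : Fin n → Γ₀) (hτ0 : ∀ i, τ i ≠ 0)
    (hind : ∀ m : Fin n → ℤ, (∏ i, τ i ^ (m i)) = 1 → m = 0) (θ : Γ₀) (hθ0 : θ ≠ 0)
    (α : Fin n → ℕ) (hθp : θ ^ p = ∏ i, τ i ^ (α i))
    (hθ : ∀ m : Fin n → ℤ, θ ≠ ∏ i, τ i ^ (m i)) (a : Fin n → ℤ) (r : ℕ) (hr : r < p)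
    (h : (∏ i, τ i ^ (a i)) * θ ^ r = 1) : r = 0 ∧ a = 0 := by
  have hθr : θ ^ (r : ℤ) = ∏ i, τ i ^ ((-a) i) := by
    rw [prod_zpow_neg_eq, zpow_natCast]
    exact eq_inv_of_mul_eq_one_right h
  have hθp' : θ ^ (p : ℤ) = ∏ i, τ i ^ ((fun i => (α i : ℤ)) i) := by
    rw [zpow_natCast, hθp]
    exact Finset.prod_congr rfl fun i _ => (zpow_natCast _ _).symm
  have hr0 : r = 0 := by
    by_contra hr0
    have hcop : Nat.Coprime p r :=
      (Nat.Prime.coprime_iff_not_dvd hp).mpr (Nat.not_dvd_of_pos_of_lt (Nat.pos_of_ne_zero hr0) hr)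
    obtain ⟨s, s', hss⟩ := Nat.isCoprime_iff_coprime.mpr hcop
    apply hθ (s • (fun i => (α i : ℤ)) + s' • (-a))
    rw [prod_zpow_add_eq τ hτ0, prod_zpow_smul_eq, prod_zpow_smul_eq, ← hθp', ← hθr,
      ← zpow_mul, ← zpow_mul, ← zpow_add₀ hθ0, mul_comm (p : ℤ) s, mul_comm (r : ℤ) s', hss,
      zpow_one]
  refine ⟨hr0, hind a ?_⟩
  rw [hr0, pow_zero, mul_one] at h
  exact h

end Rebase

end Summit.ResolutionOfSingularities.ResolutionOfSingularities.Theorems.PfaffLine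

end
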